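import Mathlib
import Literature.Probability.RandomPlanarGeometry.HexParafermion
import Literature.Probability.RandomPlanarGeometry.HexSAW

/-!
SketchIdeator1 — first lemmas of the crux-idea cards for QCIdentification (stmt-CriticalPhenomena-8298).
Elaboration only; nothing is proved here.
-/

noncomputable section

open Literature.Probability.LatticeModels Literature.Probability.RandomPlanarGeometry.SAW

namespace Summit.CriticalPhenomena.SAWScalingLimit.Cruxes.QCIdentification.Sketch

/-- Card `twist-free-riemann-hilbert-rigidity`, first lemma (NO PHASE VORTICES): at a vertex where
the DCS relation kills one `ℤ/3`-mode and the no-fold inequality with constant `k` bounds the other,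
each of the three mid-edge values lies in the disc of radius `k‖S‖/3` about `S/3`, `S` the sum; for
`k < 1` they are non-zero and any two differ in argument by less than `2 arcsin k < π`, so under
`NoFoldBound` the observable has a global single-valued lattice argument on a simply connected
domain. Pure `ℤ/3`-Fourier inversion. -/
def NoVortexDisc : Prop :=
  ∀ (k : ℝ) (F₀ F₁ F₂ : ℂ),
    let ω : ℂ := Complex.exp (2 * Real.pi * Complex.I / 3)
    F₀ + ω ^ 2 * F₁ + ω * F₂ = 0 →
    ‖F₀ + ω * F₁ + ω ^ 2 * F₂‖ ≤ k * ‖F₀ + F₁ + F₂‖ →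
      ‖3 * F₀ - (F₀ + F₁ + F₂)‖ ≤ k * ‖F₀ + F₁ + F₂‖ ∧
      ‖3 * F₁ - (F₀ + F₁ + F₂)‖ ≤ k * ‖F₀ + F₁ + F₂‖ ∧
      ‖3 * F₂ - (F₀ + F₁ + F₂)‖ ≤ k * ‖F₀ + F₁ + F₂‖

/-- Card `twist-free-riemann-hilbert-rigidity`, first lemma over the observable (NON-VANISHING under
the pointwise no-fold inequality): if at every vertex of a simply connected `Λ` both labelled
`ℤ/3`-combinations are bounded by `k < 1` times the sum (this is `NoFoldBound` at `Λ, a`), then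
`F = F(a, ·, x_c, 5/8)` vanishes at no mid-edge of `Λ` (else the disc lemma forces the sum, hence all
three values at that vertex, to vanish, and the zero set propagates to `a`, where `F(a) = 1`). -/
def NoFoldNonvanishing : Prop :=
  ∀ (k : ℝ), k < 1 → ∀ (Λ : Finset HexVertex), hexDomainSimplyConnected Λ →
    (hexGraph.induce ((Λ : Finset HexVertex) : Set HexVertex)).Preconnected →
    ∀ a ∈ hexDomainBoundary Λ,
      (∀ v ∈ Λ, ∀ w₀ w₁ w₂ : HexVertex, hexGraph.Adj v w₀ → hexGraph.Adj v w₁ → hexGraph.Adj v w₂ →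
        w₀ ≠ w₁ → w₁ ≠ w₂ → w₀ ≠ w₂ →
        let F : Sym2 HexVertex → ℂ := hexParafermionicObservable Λ a hexCriticalFugacity (5 / 8)
        let ω : ℂ := Complex.exp (2 * Real.pi * Complex.I / 3)
        ‖F s(v, w₀) + ω * F s(v, w₁) + ω ^ 2 * F s(v, w₂)‖ ≤
          k * ‖F s(v, w₀) + F s(v, w₁) + F s(v, w₂)‖) →
      ∀ v ∈ Λ, ∀ w : HexVertex, hexGraph.Adj v w →
        hexParafermionicObservable Λ a hexCriticalFugacity (5 / 8) s(v, w) ≠ 0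

/-- Card `flat-row-reflection-bridge-saturation`, first lemma (EXACT STRAIGHTNESS OF THE IMAGE OF A
FLAT ZIGZAG ROW): if near the boundary mid-edge `b` the domain is exactly the lattice half-plane of
rows `≥ m` (the flatness hypothesis of `HexObservableLimit`), then every dangling mid-edge of that
row inside the flat window carries the observable with ONE common phase (deterministic winding,
zero turning along the row) and positive modulus (at least one walk): the edges `(p - v) F(p)` of
the image polygon along the row are parallel and equi-oriented, i.e. the developing map sends the
row into a straight line — the input of the Schwarz reflection. -/
def FlatRowCommonPhase : Prop :=
  ∀ (Λ : Finset HexVertex) (a b : Sym2 HexVertex) (m : ℤ) (ρ : ℝ),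
    hexDomainSimplyConnected Λ → a ∈ hexDomainBoundary Λ → b ∈ hexDomainBoundary Λ → a ≠ b →
    0 < ρ → ρ < dist (hexMidpoint a) (hexMidpoint b) →
    (∀ v : HexVertex, dist (hexCenter v) (hexMidpoint b) ≤ ρ → (v ∈ Λ ↔ m ≤ v.1 1)) →
    ∃ θ : ℝ, ∀ (x : Site 2), x 1 = m →
      dist (hexCenter (x, 0)) (hexMidpoint b) ≤ ρ / 2 →
      let p : Sym2 HexVertex := s((x, 0), (x - Pi.single 1 1, 1))
      let F : ℂ := hexParafermionicObservable Λ a hexCriticalFugacity (5 / 8) p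
      F = (‖F‖ : ℂ) * Complex.exp (θ * Complex.I) ∧ 0 < ‖F‖

/-- Card `flat-row-reflection-bridge-saturation`, the lattice input it isolates (ROW RATIO LIMIT,
(RL)): along the flat window the boundary generating function has no lattice-scale oscillation —
the ratio of the observable at two consecutive dangling mid-edges of the flat row tends to `1`,
uniformly over admissible configurations, as the flat window (in lattice units) and the distance to
the source grow. Stated for one lattice step `x ↦ x + e₀`. -/
def RowRatioLimit : Prop :=
  ∀ ε : ℝ, 0 < ε → ∃ R : ℝ, ∀ (Λ : Finset HexVertex) (a b : Sym2 HexVertex) (m : ℤ),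
    hexDomainSimplyConnected Λ → a ∈ hexDomainBoundary Λ → b ∈ hexDomainBoundary Λ →
    R < dist (hexMidpoint a) (hexMidpoint b) →
    (∀ v : HexVertex, dist (hexCenter v) (hexMidpoint b) ≤ R → (v ∈ Λ ↔ m ≤ v.1 1)) →
    ∀ (x : Site 2), x 1 = m → dist (hexCenter (x, 0)) (hexMidpoint b) ≤ 1 →
      let F : Sym2 HexVertex → ℂ := hexParafermionicObservable Λ a hexCriticalFugacity (5 / 8)
      ‖F s((x + Pi.single 0 1, 0), (x + Pi.single 0 1 - Pi.single 1 1, 1)) -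
          F s((x, 0), (x - Pi.single 1 1, 1))‖ ≤ ε * ‖F s((x, 0), (x - Pi.single 1 1, 1))‖

/-- Card `twist-free-riemann-hilbert-rigidity`, the lattice statement its Transfer isolates, in
its normalisation-free form (WEDGE EXPONENT ISOTROPY = ZERO TWIST DIFFERENCE): in the lattice sector
of opening `απ` between the directions `θ₁` and `θ₁ + απ`, truncated at radius `R`, with the source
at the middle of the arc, the modulus of the observable along the bisector decays near the corner
with the conformal exponent `(5/8)(1/α - 1)` WHATEVER the orientation `θ₁` of the wedge relative to
the lattice (a boundary-layer twist `t₂ - t₁` between the two sides would shift the image corner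
angle `π(5/8 + 3α/8)` by `t₂ - t₁` and the exponent by `(t₂ - t₁)/(απ)`). Double limit `R → ∞`
then `r → ∞`; the geometry of `Λ`, `a`, `z₁`, `z_r` is passed as hypotheses. -/
def WedgeExponentIsotropy : Prop :=
  ∀ (θ₁ α : ℝ), 0 < α → α < 2 → ∀ ε : ℝ, 0 < ε → ∃ r₀ : ℝ, ∀ r : ℝ, r₀ ≤ r → ∃ R₀ : ℝ, ∀ R : ℝ, R₀ ≤ R →
    ∀ (Λ : Finset HexVertex) (a z₁ zr : Sym2 HexVertex),
      hexDomainSimplyConnected Λ → a ∈ hexDomainBoundary Λ →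
      (∀ v : HexVertex, v ∈ Λ ↔ (‖hexCenter v‖ < R ∧
          ∃ t : ℝ, θ₁ < t ∧ t < θ₁ + α * Real.pi ∧
            hexCenter v = (‖hexCenter v‖ : ℂ) * Complex.exp (t * Complex.I))) →
      dist (hexMidpoint a) ((R : ℂ) * Complex.exp ((θ₁ + α * Real.pi / 2) * Complex.I)) ≤ 2 →
      z₁ ∈ hexDomainMidEdges Λ → zr ∈ hexDomainMidEdges Λ →
      dist (hexMidpoint z₁) (Complex.exp ((θ₁ + α * Real.pi / 2) * Complex.I)) ≤ 2 →
      dist (hexMidpoint zr) ((r : ℂ) * Complex.exp ((θ₁ + α * Real.pi / 2) * Complex.I)) ≤ 2 →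
      let F : Sym2 HexVertex → ℂ := hexParafermionicObservable Λ a hexCriticalFugacity (5 / 8)
      F z₁ ≠ 0 → F zr ≠ 0 →
        |Real.log (‖F zr‖ / ‖F z₁‖) / Real.log r - (5 / 8) * (1 / α - 1)| ≤ ε

end Summit.CriticalPhenomena.SAWScalingLimit.Cruxes.QCIdentification.Sketch
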